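import Literature.NumberTheory.Automorphic.GodementJacquetLemma610Bounded
import Literature.NumberTheory.Automorphic.CartanDecompositionGLnPowers
import Literature.NumberTheory.Automorphic.GLnSphericalHeckeAlgebraIntegralGenerators

/-!
# The primitive double cosets `K diag(ϖ^m, 1) K` of `GL₂` and the partition `Δ_{m+2} K ∕ K = K diag(ϖ^{m+2},1) K ∕ K ⊔ ϖ·(Δ_m K ∕ K)`
# (LOCAL SEAM of s23, engine F2 of #28s — coset half)

Track B ∕ K2-LIT, hLiu418 = stmt-HodgeConjecture-24832; socket #28s `sig_K2LiuUnramifiedDoublingHeckeIdentity` (U5b ED. 3).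
Helper (count-neutral, own head per LEAD R3), GENERIC over a valued field `F` (`ValuativeRel F`), a uniformizing element `ϖ`
(`IsUniformizingElement`), `K = GL₂(𝒪) = glInt 2 F`; `z = ϖ·1₂ = zpowDiagGL (fun _ => 1)` is the central generator and
`D(m) = diag(ϖ^m, 1) = zpowDiagGL ![m, 0]` the PRIMITIVE Cartan representatives:

* §1–§2 integrality and «`z⁻¹ y` integral» are bi-`K`-invariant; `z·Δ_m ⊆ Δ_{m+2}` and `y ∈ Δ_{m+2}`, `z⁻¹y` integral ⟹ `z⁻¹y ∈ Δ_m`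
  (`Δ_m = glIntDet 2 ϖ m` of ★ `TamagawaHeckeSeries`: integral, `|det y| = |ϖ|^m`);
* §3 **the primitive dichotomy** `mem_doubleCoset_diag_of_not_isIntegralMatrix`: `y ∈ Δ_m` with `z⁻¹ y` NOT integral lies in `K D(m) K`
  (Cartan decomposition ★ `exists_glInt_mul_mul_eq_zpowDiagGL`: integrality forces `a₂ ≥ 0`, primitivity `a₂ ≤ 0`, the determinant `a₁ + a₂ = m`),
  and conversely `K D(m) K` is primitive;
* §4 **`setOf_out_mem_glIntDet_add_two`** ∕ `disjoint_orbit_diag_image_smul`: the set of left cosets `Δ_{m+2} K ∕ K` is the DISJOINT union of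
  the `K`-orbit of `D(m+2) K` and of `z · (Δ_m K ∕ K)` — the coset form of Shimura's `T(p^k) = T(1, p^k) + T(p,p) T(p^{k-2})`.

The operator form and the eigenvalues are in the sequel `K2LiuGL2HeckePrimitiveSplit`. ([ShimuraIATAF1971, Thm. 3.24 (2)];
[Macdonald1995, Ch. V §2–§3]; [Li1992, §3]). Theorems only; no `sorry`.
HONEST LABEL: HC_CM is proved only modulo the printed citations (2 remaining named inputs: hLiu418 = stmt-HodgeConjecture-24832, h413 =
stmt-HodgeConjecture-24833) until rung 0 closes; this file is unconditional and moves no counter.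
-/

set_option autoImplicit false

set_option linter.dupNamespace false

noncomputable section

open scoped Pointwise
open MulAction ValuativeRel Matrix

namespace Summit.HodgeConjecture.HodgeConjecture.Cruxes.HLiu418.K2LiuGL2PrimitiveCosets

open Literature.NumberTheory.Automorphic

variable {F : Type*} [Field F] [ValuativeRel F] {n : ℕ} {ϖ : F}

/-! ## §1 Integral matrices: bi-`K`-invariance, diagonal representatives -/

/-- left multiplication by `K` preserves integrality. [cite: ShimuraIATAF1971, §3.2] -/
theorem isIntegralMatrix_glInt_mul_iff {κ : GL (Fin n) F} (hκ : κ ∈ glInt n F) (y : GL (Fin n) F) :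
    IsIntegralMatrix ((κ * y : GL (Fin n) F) : Matrix (Fin n) (Fin n) F) ↔ IsIntegralMatrix (y : Matrix (Fin n) (Fin n) F) := by
  refine ⟨fun h => ?_, fun h => ?_⟩
  · have h' := (isIntegralMatrix_inv_of_mem_glInt hκ).mul h
    rwa [Units.val_mul, ← Matrix.mul_assoc, ← Units.val_mul, inv_mul_cancel, Units.val_one, Matrix.one_mul] at h'
  · rw [Units.val_mul]
    exact (isIntegralMatrix_of_mem_glInt hκ).mul h

/-- `|ϖ^j| ≤ 1 ↔ 0 ≤ j` for a uniformizing element. [cite: CasselsFrohlichANT1967, Ch. II §10] -/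
theorem valuation_zpow_le_one_iff (hϖ : IsUniformizingElement ϖ) (j : ℤ) : valuation F (ϖ ^ j) ≤ 1 ↔ 0 ≤ j := by
  rw [map_zpow₀]
  exact zpow_le_one_iff_right_of_lt_one₀ ((Valuation.pos_iff _).mpr hϖ.ne_zero) hϖ.valuation_lt_one

/-- an integral diagonal matrix `diag(ϖ^{a_i})` has all `a_i ≥ 0` (cf. ★ `isIntegralMatrix_coe_zpowDiagGL_iff` of `SchwartzBruhatLatticeSpan`,
whose module is not importable here). [cite: Macdonald1995, Ch. V §2] -/
theorem nonneg_of_isIntegralMatrix_zpowDiagGL (hϖ : IsUniformizingElement ϖ) (a : Fin n → ℤ)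
    (h : IsIntegralMatrix ((zpowDiagGL hϖ.ne_zero a : GL (Fin n) F) : Matrix (Fin n) (Fin n) F)) (i : Fin n) : 0 ≤ a i := by
  rw [coe_zpowDiagGL] at h
  have := h i i
  rw [Matrix.diagonal_apply_eq, Valuation.mem_integer_iff] at this
  exact (valuation_zpow_le_one_iff hϖ (a i)).1 this

/-- `|det diag(ϖ^{a_i})| = |ϖ|^{∑ a_i}` for `a ≥ 0`. [cite: ShimuraIATAF1971, §3.2] -/
theorem valuation_det_zpowDiagGL (hϖ0 : ϖ ≠ 0) {a : Fin n → ℤ} (ha : ∀ i, 0 ≤ a i) :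
    valuation F ((zpowDiagGL hϖ0 a : GL (Fin n) F) : Matrix (Fin n) (Fin n) F).det = valuation F ϖ ^ ∑ i, (a i).toNat := by
  rw [coe_zpowDiagGL, Matrix.det_diagonal, map_prod, ← Finset.prod_pow_eq_pow_sum]
  refine Finset.prod_congr rfl fun i _ => ?_
  rw [map_zpow₀, ← zpow_natCast, Int.toNat_of_nonneg (ha i)]

/-- the diagonal matrix `diag(ϖ^{a_i})`, `a ≥ 0`, lies in `Δ_{∑ aᵢ}`. [cite: ShimuraIATAF1971, §3.2] -/
theorem zpowDiagGL_mem_glIntDet (hϖ : IsUniformizingElement ϖ) {a : Fin n → ℤ} (ha : ∀ i, 0 ≤ a i) :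
    zpowDiagGL hϖ.ne_zero a ∈ glIntDet n ϖ (∑ i, (a i).toNat) :=
  ⟨isIntegralMatrix_zpowDiagGL_of_nonneg hϖ ha, valuation_det_zpowDiagGL hϖ.ne_zero ha⟩

/-- `n ↦ |ϖ|^n` is injective. [cite: CasselsFrohlichANT1967, Ch. II §10] -/
theorem pow_valuation_injective (hϖ : IsUniformizingElement ϖ) {i j : ℕ} (h : valuation F ϖ ^ i = valuation F ϖ ^ j) : i = j := by
  have hpos : 0 < valuation F ϖ := (Valuation.pos_iff _).mpr hϖ.ne_zero
  have hlt : valuation F ϖ < 1 := hϖ.valuation_lt_one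
  have hanti : StrictAnti fun m : ℕ => valuation F ϖ ^ m := fun a b hab => pow_lt_pow_right_of_lt_one₀ hpos hlt hab
  exact hanti.injective h

omit [ValuativeRel F] in
/-- the scalar matrix `z = ϖ·1` commutes with everything. [cite: ShimuraIATAF1971, Prop. 3.17] -/
theorem zpowDiagGL_one_mul_comm (hϖ0 : ϖ ≠ 0) (y : GL (Fin n) F) :
    zpowDiagGL hϖ0 (fun _ => (1 : ℤ)) * y = y * zpowDiagGL hϖ0 (fun _ => (1 : ℤ)) :=
  (mul_zpowDiagGL_const_comm hϖ0 1 y).symm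

omit [ValuativeRel F] in
/-- `z⁻¹ · diag(ϖ^{a_i}) = diag(ϖ^{a_i - 1})`. [cite: ShimuraIATAF1971, Prop. 3.17] -/
theorem zpowDiagGL_one_inv_mul_zpowDiagGL (hϖ0 : ϖ ≠ 0) (a : Fin n → ℤ) :
    (zpowDiagGL hϖ0 (fun _ => (1 : ℤ)))⁻¹ * zpowDiagGL hϖ0 a = zpowDiagGL hϖ0 (fun i => a i - 1) := by
  rw [← zpowDiagGL_neg, ← zpowDiagGL_add]
  congr 1
  funext i
  simp only [Pi.add_apply, Pi.neg_apply]
  ring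

/-! ## §2 The non-primitive integral matrices `z · Δ_m` -/

/-- left `K`-multiplication preserves «`z⁻¹ y` integral» (`z` central). [cite: ShimuraIATAF1971, Prop. 3.17] -/
theorem isIntegralMatrix_inv_scalar_mul_glInt_mul_iff (hϖ0 : ϖ ≠ 0) {κ : GL (Fin n) F} (hκ : κ ∈ glInt n F) (y : GL (Fin n) F) :
    IsIntegralMatrix (((zpowDiagGL hϖ0 (fun _ => (1 : ℤ)))⁻¹ * (κ * y) : GL (Fin n) F) : Matrix (Fin n) (Fin n) F) ↔
      IsIntegralMatrix (((zpowDiagGL hϖ0 (fun _ => (1 : ℤ)))⁻¹ * y : GL (Fin n) F) : Matrix (Fin n) (Fin n) F) := by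
  have hc : (zpowDiagGL hϖ0 (fun _ => (1 : ℤ)))⁻¹ * (κ * y) = κ * ((zpowDiagGL hϖ0 (fun _ => (1 : ℤ)))⁻¹ * y) := by
    rw [← mul_assoc, ← mul_assoc]
    congr 1
    rw [inv_mul_eq_iff_eq_mul, ← mul_assoc, zpowDiagGL_one_mul_comm hϖ0 κ, mul_assoc, mul_inv_cancel, mul_one]
  rw [hc, isIntegralMatrix_glInt_mul_iff hκ]

/-- right `K`-multiplication preserves «`z⁻¹ y` integral». [cite: ShimuraIATAF1971, Prop. 3.17] -/
theorem isIntegralMatrix_inv_scalar_mul_mul_glInt_iff (hϖ0 : ϖ ≠ 0) {κ : GL (Fin n) F} (hκ : κ ∈ glInt n F) (y : GL (Fin n) F) :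
    IsIntegralMatrix (((zpowDiagGL hϖ0 (fun _ => (1 : ℤ)))⁻¹ * (y * κ) : GL (Fin n) F) : Matrix (Fin n) (Fin n) F) ↔
      IsIntegralMatrix (((zpowDiagGL hϖ0 (fun _ => (1 : ℤ)))⁻¹ * y : GL (Fin n) F) : Matrix (Fin n) (Fin n) F) := by
  rw [← mul_assoc, isIntegralMatrix_mul_glInt_iff hκ]

/-- `Δ`-membership is multiplicative in the determinant exponent: `y ∈ Δ_m`, `y' ∈ Δ_{m'}` ⟹ `y y' ∈ Δ_{m+m'}`.
[cite: ShimuraIATAF1971, §3.2] -/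
theorem mul_mem_glIntDet {y y' : GL (Fin n) F} {m m' : ℕ} (hy : y ∈ glIntDet n ϖ m) (hy' : y' ∈ glIntDet n ϖ m') :
    y * y' ∈ glIntDet n ϖ (m + m') := by
  refine ⟨by rw [Units.val_mul]; exact hy.1.mul hy'.1, ?_⟩
  rw [Units.val_mul, Matrix.det_mul, map_mul, hy.2, hy'.2, pow_add]

/-- the central generator `z = ϖ·1₂` lies in `Δ_2`. [cite: ShimuraIATAF1971, §3.2] -/
theorem scalar_mem_glIntDet_two (hϖ : IsUniformizingElement ϖ) :
    zpowDiagGL hϖ.ne_zero (fun _ : Fin 2 => (1 : ℤ)) ∈ glIntDet 2 ϖ 2 := by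
  have h := zpowDiagGL_mem_glIntDet (n := 2) hϖ (a := fun _ => (1 : ℤ)) fun _ => zero_le_one
  simpa using h

/-- `z · Δ_m ⊆ Δ_{m+2}`. [cite: ShimuraIATAF1971, §3.2] -/
theorem scalar_mul_mem_glIntDet (hϖ : IsUniformizingElement ϖ) {y : GL (Fin 2) F} {m : ℕ} (hy : y ∈ glIntDet 2 ϖ m) :
    zpowDiagGL hϖ.ne_zero (fun _ : Fin 2 => (1 : ℤ)) * y ∈ glIntDet 2 ϖ (m + 2) := by
  rw [add_comm]
  exact mul_mem_glIntDet (scalar_mem_glIntDet_two hϖ) hy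

/-- if `y ∈ Δ_{m+2}` and `z⁻¹ y` is integral then `z⁻¹ y ∈ Δ_m`. [cite: ShimuraIATAF1971, Thm. 3.24 (2)] -/
theorem inv_scalar_mul_mem_glIntDet (hϖ : IsUniformizingElement ϖ) {y : GL (Fin 2) F} {m : ℕ} (hy : y ∈ glIntDet 2 ϖ (m + 2))
    (hint : IsIntegralMatrix (((zpowDiagGL hϖ.ne_zero (fun _ => (1 : ℤ)))⁻¹ * y : GL (Fin 2) F) : Matrix (Fin 2) (Fin 2) F)) :
    (zpowDiagGL hϖ.ne_zero (fun _ => (1 : ℤ)))⁻¹ * y ∈ glIntDet 2 ϖ m := by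
  refine ⟨hint, ?_⟩
  have hz := (scalar_mem_glIntDet_two hϖ).2
  have hprod : valuation F ((zpowDiagGL hϖ.ne_zero (fun _ : Fin 2 => (1 : ℤ)) : GL (Fin 2) F) : Matrix (Fin 2) (Fin 2) F).det *
      valuation F ((((zpowDiagGL hϖ.ne_zero (fun _ => (1 : ℤ)))⁻¹ * y : GL (Fin 2) F)) : Matrix (Fin 2) (Fin 2) F).det =
        valuation F ϖ ^ 2 * valuation F ϖ ^ m := by
    rw [← map_mul, ← Matrix.det_mul, ← Units.val_mul, mul_inv_cancel_left, hy.2, ← pow_add, add_comm]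
  rw [hz] at hprod
  exact mul_left_cancel₀ (pow_ne_zero _ ((Valuation.ne_zero_iff _).2 hϖ.ne_zero)) hprod

/-! ## §3 The primitive matrices of `Δ_m` form the single double coset `K D(m) K` -/

/-- `D(m) = diag(ϖ^m, 1) ∈ Δ_m`. [cite: ShimuraIATAF1971, Thm. 3.24] -/
theorem diag_mem_glIntDet (hϖ : IsUniformizingElement ϖ) (m : ℕ) : zpowDiagGL hϖ.ne_zero ![(m : ℤ), 0] ∈ glIntDet 2 ϖ m := by
  have h := zpowDiagGL_mem_glIntDet (n := 2) hϖ (a := ![(m : ℤ), 0]) (fun i => by fin_cases i <;> simp)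
  simpa using h

/-- `z⁻¹ D(m)` is not integral (its `(1,1)` entry is `ϖ⁻¹`). [cite: ShimuraIATAF1971, Thm. 3.24 (2)] -/
theorem not_isIntegralMatrix_inv_scalar_mul_diag (hϖ : IsUniformizingElement ϖ) (m : ℕ) :
    ¬ IsIntegralMatrix (((zpowDiagGL hϖ.ne_zero (fun _ => (1 : ℤ)))⁻¹ * zpowDiagGL hϖ.ne_zero ![(m : ℤ), 0] : GL (Fin 2) F) :
      Matrix (Fin 2) (Fin 2) F) := by
  rw [zpowDiagGL_one_inv_mul_zpowDiagGL]
  intro h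
  have := nonneg_of_isIntegralMatrix_zpowDiagGL hϖ _ h 1
  simp at this

/-- primitivity is a property of the double coset: for `y ∈ K D(m) K`, `z⁻¹ y` is not integral. [cite: ShimuraIATAF1971, Thm. 3.24 (2)] -/
theorem not_isIntegralMatrix_of_mem_doubleCoset (hϖ : IsUniformizingElement ϖ) (m : ℕ) {y : GL (Fin 2) F}
    (hy : y ∈ DoubleCoset.doubleCoset (zpowDiagGL hϖ.ne_zero ![(m : ℤ), 0]) (glInt 2 F : Set (GL (Fin 2) F)) (glInt 2 F)) :
    ¬ IsIntegralMatrix (((zpowDiagGL hϖ.ne_zero (fun _ => (1 : ℤ)))⁻¹ * y : GL (Fin 2) F) : Matrix (Fin 2) (Fin 2) F) := by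
  obtain ⟨κ₁, hκ₁, κ₂, hκ₂, rfl⟩ := DoubleCoset.mem_doubleCoset.1 hy
  rw [isIntegralMatrix_inv_scalar_mul_mul_glInt_iff hϖ.ne_zero hκ₂, isIntegralMatrix_inv_scalar_mul_glInt_mul_iff hϖ.ne_zero hκ₁]
  exact not_isIntegralMatrix_inv_scalar_mul_diag hϖ m

/-- **the primitive dichotomy**: a matrix of `Δ_m` with `z⁻¹ y` NOT integral lies in `K D(m) K` (Cartan decomposition with unique
antitone exponents `a₁ ≥ a₂`: integrality forces `a₂ ≥ 0`, primitivity `a₂ ≤ 0`, the determinant `a₁ + a₂ = m`).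
[cite: Macdonald1995, Ch. V §2 (2.2)] [cite: ShimuraIATAF1971, Thm. 3.24 (2)] -/
theorem mem_doubleCoset_diag_of_not_isIntegralMatrix [IsDiscreteValuationRing 𝒪[F]] (hϖ : IsUniformizingElement ϖ) {m : ℕ} {y : GL (Fin 2) F} (hy : y ∈ glIntDet 2 ϖ m)
    (hprim : ¬ IsIntegralMatrix (((zpowDiagGL hϖ.ne_zero (fun _ => (1 : ℤ)))⁻¹ * y : GL (Fin 2) F) : Matrix (Fin 2) (Fin 2) F)) :
    y ∈ DoubleCoset.doubleCoset (zpowDiagGL hϖ.ne_zero ![(m : ℤ), 0]) (glInt 2 F : Set (GL (Fin 2) F)) (glInt 2 F) := by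
  obtain ⟨k₁, hk₁, k₂, hk₂, a, ha, h⟩ := exists_glInt_mul_mul_eq_zpowDiagGL hϖ y
  -- the diagonal representative inherits membership in `Δ_m` and primitivity
  have hmem : zpowDiagGL hϖ.ne_zero a ∈ glIntDet 2 ϖ m := by
    rw [← h, mul_glInt_mem_glIntDet_iff hk₂, glInt_mul_mem_glIntDet_iff hk₁]
    exact hy
  have hpos : ∀ i, 0 ≤ a i := nonneg_of_isIntegralMatrix_zpowDiagGL hϖ a hmem.1
  have hprim' : ¬ IsIntegralMatrix (((zpowDiagGL hϖ.ne_zero (fun _ => (1 : ℤ)))⁻¹ * zpowDiagGL hϖ.ne_zero a : GL (Fin 2) F) :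
      Matrix (Fin 2) (Fin 2) F) := by
    rw [← h, isIntegralMatrix_inv_scalar_mul_mul_glInt_iff hϖ.ne_zero hk₂, isIntegralMatrix_inv_scalar_mul_glInt_mul_iff hϖ.ne_zero hk₁]
    exact hprim
  rw [zpowDiagGL_one_inv_mul_zpowDiagGL] at hprim'
  obtain ⟨i, hi⟩ := not_forall.1 fun hall => hprim' (isIntegralMatrix_zpowDiagGL_of_nonneg hϖ hall)
  have ha1 : a 1 = 0 := by
    have h10 : a 1 ≤ a 0 := ha (Fin.zero_le _)
    have := hpos 1
    have := hpos 0
    fin_cases i <;> simp only [Fin.zero_eta, Fin.mk_one, Fin.isValue] at hi <;> omega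
  have ha0 : a 0 = m := by
    have hdet := hmem.2
    rw [valuation_det_zpowDiagGL hϖ.ne_zero hpos] at hdet
    have hsum := pow_valuation_injective hϖ hdet
    simp only [Fin.sum_univ_two, ha1, Int.toNat_zero, add_zero] at hsum
    have := hpos 0
    omega
  have hav : a = ![(m : ℤ), 0] := by
    funext i
    fin_cases i
    · simpa using ha0
    · simpa using ha1
  rw [hav] at h
  refine DoubleCoset.mem_doubleCoset.2 ⟨k₁⁻¹, Subgroup.inv_mem _ hk₁, k₂⁻¹, Subgroup.inv_mem _ hk₂, ?_⟩
  rw [← h]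
  group

/-! ## §4 `Δ_{m+2} K ∕ K = K D(m+2) K ∕ K ⊔ z · (Δ_m K ∕ K)` -/

section Cosets

variable {G : Type*} [Group G] {K : Subgroup G}

/-- representatives of cosets in the orbit of `gK` lie in `KgK`. [cite: ShimuraIATAF1971, §3.1 Prop. 3.1] -/
theorem out_mem_doubleCoset_of_mem_orbit {g : G} {γ : G ⧸ K} (hγ : γ ∈ orbit K (g : G ⧸ K)) :
    γ.out ∈ DoubleCoset.doubleCoset g (K : Set G) K := by
  obtain ⟨κ, rfl⟩ := (mem_orbit_mk_iff K).1 hγ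
  obtain ⟨h, hh⟩ := QuotientGroup.mk_out_eq_mul K ((κ : G) * g)
  rw [hh]
  exact DoubleCoset.mem_doubleCoset.2 ⟨κ, κ.2, h, h.2, rfl⟩

/-- the coset of an element of `KgK` lies in the orbit of `gK`. [cite: ShimuraIATAF1971, §3.1 Prop. 3.1] -/
theorem mk_mem_orbit_of_mem_doubleCoset {g y : G} (hy : y ∈ DoubleCoset.doubleCoset g (K : Set G) K) :
    (y : G ⧸ K) ∈ orbit K (g : G ⧸ K) := by
  obtain ⟨κ₁, hκ₁, κ₂, hκ₂, rfl⟩ := DoubleCoset.mem_doubleCoset.1 hy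
  refine (mem_orbit_mk_iff K).2 ⟨⟨κ₁, hκ₁⟩, ?_⟩
  rw [QuotientGroup.eq, show ((⟨κ₁, hκ₁⟩ : K) * g : G)⁻¹ * (κ₁ * g * κ₂) = κ₂ by group]
  exact hκ₂

end Cosets

/-- the orbit of `D(m) K` consists of cosets of `Δ_m`. [cite: ShimuraIATAF1971, Thm. 3.24] -/
theorem out_mem_glIntDet_of_mem_orbit_diag (hϖ : IsUniformizingElement ϖ) (m : ℕ) {γ : GL (Fin 2) F ⧸ glInt 2 F}
    (hγ : γ ∈ orbit (glInt 2 F) ((zpowDiagGL hϖ.ne_zero ![(m : ℤ), 0] : GL (Fin 2) F) : GL (Fin 2) F ⧸ glInt 2 F)) :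
    γ.out ∈ glIntDet 2 ϖ m := by
  obtain ⟨κ₁, hκ₁, κ₂, hκ₂, h⟩ := DoubleCoset.mem_doubleCoset.1 (out_mem_doubleCoset_of_mem_orbit hγ)
  rw [h, mul_glInt_mem_glIntDet_iff hκ₂, glInt_mul_mem_glIntDet_iff hκ₁]
  exact diag_mem_glIntDet hϖ m

/-- the orbit of `D(m) K` is finite. [cite: ShimuraIATAF1971, §3.1 Prop. 3.1] -/
theorem finite_orbit_diag [Finite 𝓀[F]] (hϖ : IsUniformizingElement ϖ) (m : ℕ) :
    (orbit (glInt 2 F) ((zpowDiagGL hϖ.ne_zero ![(m : ℤ), 0] : GL (Fin 2) F) : GL (Fin 2) F ⧸ glInt 2 F)).Finite :=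
  (finite_cosets_glIntDet hϖ m).subset fun _ hγ => out_mem_glIntDet_of_mem_orbit_diag hϖ m hγ

/-- **`Δ_{m+2} K ∕ K ⊆ K D(m+2) K ∕ K ∪ z · (Δ_m K ∕ K)`** (and conversely): the primitive dichotomy on cosets.
[cite: ShimuraIATAF1971, Thm. 3.24 (2)] -/
theorem setOf_out_mem_glIntDet_add_two [IsDiscreteValuationRing 𝒪[F]] (hϖ : IsUniformizingElement ϖ) (m : ℕ) :
    {γ : GL (Fin 2) F ⧸ glInt 2 F | γ.out ∈ glIntDet 2 ϖ (m + 2)} =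
      orbit (glInt 2 F) ((zpowDiagGL hϖ.ne_zero ![((m + 2 : ℕ) : ℤ), 0] : GL (Fin 2) F) : GL (Fin 2) F ⧸ glInt 2 F) ∪
        (fun γ => zpowDiagGL hϖ.ne_zero (fun _ : Fin 2 => (1 : ℤ)) • γ) '' {γ : GL (Fin 2) F ⧸ glInt 2 F | γ.out ∈ glIntDet 2 ϖ m} := by
  ext γ
  simp only [Set.mem_setOf_eq, Set.mem_union, Set.mem_image]
  constructor
  · intro hγ
    by_cases hint : IsIntegralMatrix (((zpowDiagGL hϖ.ne_zero (fun _ => (1 : ℤ)))⁻¹ * γ.out : GL (Fin 2) F) : Matrix (Fin 2) (Fin 2) F)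
    · -- non-primitive: `γ = z • (z⁻¹ γ.out) K`
      refine Or.inr ⟨(((zpowDiagGL hϖ.ne_zero (fun _ => (1 : ℤ)))⁻¹ * γ.out : GL (Fin 2) F) : GL (Fin 2) F ⧸ glInt 2 F), ?_, ?_⟩
      · rw [mk_out_mem_glIntDet_iff]
        exact inv_scalar_mul_mem_glIntDet hϖ hγ hint
      · rw [MulAction.Quotient.smul_mk, smul_eq_mul, mul_inv_cancel_left, QuotientGroup.out_eq']
    · -- primitive: `γ.out ∈ K D(m+2) K`
      left
      have h := mk_mem_orbit_of_mem_doubleCoset (mem_doubleCoset_diag_of_not_isIntegralMatrix hϖ hγ hint)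
      rwa [QuotientGroup.out_eq'] at h
  · rintro (hγ | ⟨γ', hγ', rfl⟩)
    · exact out_mem_glIntDet_of_mem_orbit_diag hϖ (m + 2) hγ
    · rw [smul_out_mem_glIntDet_iff']
      exact scalar_mul_mem_glIntDet hϖ hγ'

/-- **the two parts are disjoint** (primitive vs. non-primitive). [cite: ShimuraIATAF1971, Thm. 3.24 (2)] -/
theorem disjoint_orbit_diag_image_smul (hϖ : IsUniformizingElement ϖ) (m k : ℕ) :
    Disjoint (orbit (glInt 2 F) ((zpowDiagGL hϖ.ne_zero ![(k : ℤ), 0] : GL (Fin 2) F) : GL (Fin 2) F ⧸ glInt 2 F))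
      ((fun γ => zpowDiagGL hϖ.ne_zero (fun _ : Fin 2 => (1 : ℤ)) • γ) '' {γ : GL (Fin 2) F ⧸ glInt 2 F | γ.out ∈ glIntDet 2 ϖ m}) := by
  rw [Set.disjoint_left]
  rintro γ hγ ⟨γ', hγ', rfl⟩
  refine not_isIntegralMatrix_of_mem_doubleCoset hϖ k (out_mem_doubleCoset_of_mem_orbit hγ) ?_
  -- `z⁻¹ (z • γ').out = z⁻¹ z γ'.out κ` is integral
  obtain ⟨h, hh⟩ := QuotientGroup.mk_out_eq_mul (glInt 2 F) (zpowDiagGL hϖ.ne_zero (fun _ : Fin 2 => (1 : ℤ)) * γ'.out)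
  have hmk : (zpowDiagGL hϖ.ne_zero (fun _ : Fin 2 => (1 : ℤ)) • γ' : GL (Fin 2) F ⧸ glInt 2 F) =
      ((zpowDiagGL hϖ.ne_zero (fun _ : Fin 2 => (1 : ℤ)) * γ'.out : GL (Fin 2) F) : GL (Fin 2) F ⧸ glInt 2 F) := by
    conv_lhs => rw [← QuotientGroup.out_eq' γ', MulAction.Quotient.smul_mk, smul_eq_mul]
  show IsIntegralMatrix ((((zpowDiagGL hϖ.ne_zero (fun _ => (1 : ℤ)))⁻¹ *
    (zpowDiagGL hϖ.ne_zero (fun _ : Fin 2 => (1 : ℤ)) • γ' : GL (Fin 2) F ⧸ glInt 2 F).out : GL (Fin 2) F)) : Matrix (Fin 2) (Fin 2) F)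
  rw [hmk, hh, ← mul_assoc, inv_mul_cancel_left, isIntegralMatrix_mul_glInt_iff h.2]
  exact hγ'.1

end Summit.HodgeConjecture.HodgeConjecture.Cruxes.HLiu418.K2LiuGL2PrimitiveCosets

end
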